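import Summits.ResolutionOfSingularities.ResolutionOfSingularities.Theorems.HilbertSamuelEliminationSigmaMaxModificationsCorridor3SigmaCycleDefs
import HarnessLib

/-!
# [OURS · L1 W4.2] σ-LAYER part 1b⁺ — `Corridor3SigmaCyclePlusDefs`: the END-RULE VARIANT Ω⁺ of the cycle-disciplined strategies
# (component-naming stage oracles: «line first» at a crossing)

Crux chain w42 (`SigmaMaxModifications`, stmt-ResolutionOfSingularities-18506; conjunct `SigmaMaxModificationsCorridor3`,
stmt-ResolutionOfSingularities-19249), res-L1-w42-plan-1 RULINGS v3.14-9 (CD)/(CF) (2026-08-27 09:54:20Z): «the END-RULE variant Ω⁺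
(component-naming) is the likely home — 040: have the `IsCanonicalStepΩplus` sibling text ready, file on my 10:30Z word». Sibling of part 1b
`…Corridor3SigmaCycleDefs` (p520734: `StageOracle`, `IsCanonicalStepΩ`, `OracleAdmissibleΩ`, …) over res-D-pv-047's part 1
`…Corridor3SigmaStepDefs` (`Sigma.Strategy`). Typer res-type-040 (gen 18). OURS (cell res-hironaka, slot W4.2); NOT statements of
H. Hironaka's manuscript [Hironaka2017] nor of [CossartJannsenSaito2020] beyond the typed Rem. 6.29 (1); AI-drafted, weaker than expert
review. Helper file `--supports stmt-ResolutionOfSingularities-19249` (counted 0). Definitions + transport / uniqueness lemmas; no row claimed.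

## What Ω⁺ changes with respect to Ω (and why)

In Ω (`IsCanonicalStepΩ`) the in-cycle centres named by the stage oracle must be PERMISSIBLE FOR THE TREATED PART `S` (clause kept from
`OracleAdmissible` because the CJS cycle package needs it), which by CJS Def. 3.1 (2) EXCLUDES naming a whole irreducible component of `S`
— at a crossing of two same-label `ν`-lines only POINTS can be named. The k21 loop (plan-1 RULINGS v3.13-5) is driven by the forced
point replay at such a crossing; the model's winning service (idea-2 r7, s42-pv-2) also blows up boundary CURVES, i.e. components of the
one-dimensional part. Ω⁺ makes that typable by changing exactly two things:
* the END RULE: the cycle ends by blowing up the REPLAYED SUBSCHEME'S IMAGE `V(range φ)` — the strict transform of the treated part — instead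
  of `V(Y^{(j)})` (`IsReplayStepPlus`, nil case; the cons case is `IsReplayStep`'s VERBATIM, so the identification with the strict transform,
  the push-forward centre and all their uniqueness lemmas are reused definitionally);
* ADMISSIBILITY: the oracle's centres need only be REGULAR closed subschemes of the part's tower with a REGULAR last stage
  (`OracleAdmissibleΩplus`: `t.AllRegular ∧ IsRegular t.top`) — permissibility FOR THE STAGE `W` of the pushed-forward centre then comes,
  as in the tree's centre package, from «regular, inside `X_n(ν)`, `ν` maximal» (CJS Thm. 3.3 / Lemma 5.34 (3)); a whole component (a
  boundary line) is regular, hence nameable.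
LABELS are untouched (`Labelling.next`: dominates ⇒ inherits): the rebirths of a mid-cycle component centre carry the cycle's label `j`, lie
OUTSIDE the replayed subscheme, and are treated by the NEXT cycle (least label `j` again) — exactly as the rebirths of a cycle-end centre are
in Rem. 6.29 (1). Under the CJS pending invariant «replayed subscheme = label-`j` part» (…WLadderStrataScope `CycleInv.pending`) the two END
rules coincide, so Ω⁺ and Ω (hence the CJS step, `isCanonicalStepΩ_lift_iff`) AGREE on every state of a CJS run
(`isCanonicalStepΩplus_iff_of_pending`, `isCanonicalStepΩplus_lift_iff_of_pending`) — an `Iff` on invariant states, not `Iff.rfl`.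

## Contents (namespace `…Theorems.SigmaMaxModificationsCorridor3.Sigma`)

`IsReplayStepPlus` (+ `_nil_iff` / `_cons_iff`, `_nil_iff_of_range_eq`), `IsCanonicalStepΩplus` (+ `_none_iff` / `_some_iff`,
`hsStratum_nonempty`), `OracleAdmissibleΩplus` (on locally Noetherian parts an Ω-admissible oracle is Ω⁺-admissible by the tree's
`isRegular_subscheme_of_isPermissible`; not restated),
`IsReplayStepPlus.centre_unique` / `.pending_unique`, `IsCanonicalStepΩplus.centre_unique` / `.pending_unique`, `Strategy.ofStageOraclePlus`
(+ `_step_iff` `Iff.rfl`, `Strategy.isFunctional_ofStageOraclePlus`), and the transports `isCanonicalStepΩplus_iff_of_pending`,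
`isCanonicalStepΩplus_lift_iff_of_pending`.

References: CJS LNM 2270 Rem. 6.29 (1) pp. 91–92, Def. 3.1, Thm. 3.3, Lemma 5.34 (3) [CossartJannsenSaito2020]; Görtz–Wedhorn I Prop. 13.91 (1),
13.96 (2) [GortzWedhorn2020]; tree `Literature…CanonicalEliminationSequence` (`IsReplayStep` and its API), `…Corridor3SigmaStepDefs` (p519751/p520618),
`…Corridor3SigmaCycleDefs` (p520734); STATUS res-L1-w42-plan-1 RULINGS v3.14-6 (BQ), v3.14-9 (CD)/(CF); res-type-040 CUT 09:40:20Z (5).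
-/

noncomputable section

set_option linter.dupNamespace false

open CategoryTheory AlgebraicGeometry TopologicalSpace
open Summit.ResolutionOfSingularities.ResolutionOfSingularities.Theorems.CampaignW42
open Literature.AlgebraicGeometry.Resolution Literature.RingTheory.HilbertSamuel

namespace Summit.ResolutionOfSingularities.ResolutionOfSingularities.Theorems.SigmaMaxModificationsCorridor3.Sigma

universe u

variable {W : Scheme.{u}}

/-! ## §1. The replay step with the END rule on the replayed subscheme -/

/-- [OURS · L1 W4.2] **ONE STEP OF A RESOLUTION CYCLE, END RULE ON THE REPLAYED SUBSCHEME**: inside the cycle (remaining sequence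
`D :: t`) VERBATIM the tree's `IsReplayStep` (centre = push-forward `D.map φ`, next state = `blowup D` identified with the strict
transform); when the sequence is exhausted the cycle ENDS by blowing up the IMAGE `V(range φ)` of the replayed subscheme with its reduced
structure (the strict transform of the treated part) — instead of the label part `V(Y^{(j)})`. NOT a statement of the manuscript.
[cite: CossartJannsenSaito2020, Rem. 6.29 (1)] [cite: GortzWedhorn2020, Prop. 13.96 (2)] -/
def IsReplayStepPlus (L : Labelling W) (Y : Set W) (j : ℕ) :
    {S : Scheme.{u}} → (S ⟶ W) → CentreSeq S → (C : W.IdealSheafData) → Option (Pending (blowup C)) → Prop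
  | _, φ, CentreSeq.nil _, C, P' =>
      (∃ h : IsClosed (Set.range φ.base), C = Scheme.IdealSheafData.vanishingIdeal ⟨Set.range φ.base, h⟩) ∧ P' = none
  | _, φ, CentreSeq.cons D t, C, P' => IsReplayStep L Y j φ (CentreSeq.cons D t) C P'

/-- Unfolding: the END step. [cite: CossartJannsenSaito2020, Rem. 6.29 (1)] -/
theorem isReplayStepPlus_nil_iff (L : Labelling W) (Y : Set W) (j : ℕ) {S : Scheme.{u}} (φ : S ⟶ W) (C : W.IdealSheafData)
    (P' : Option (Pending (blowup C))) :
    IsReplayStepPlus L Y j φ (CentreSeq.nil S) C P' ↔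
      (∃ h : IsClosed (Set.range φ.base), C = Scheme.IdealSheafData.vanishingIdeal ⟨Set.range φ.base, h⟩) ∧ P' = none :=
  Iff.rfl

/-- Unfolding: a step inside a cycle IS the tree's replay step (`Iff.rfl`). [cite: CossartJannsenSaito2020, Rem. 6.29 (1)] -/
theorem isReplayStepPlus_cons_iff (L : Labelling W) (Y : Set W) (j : ℕ) {S : Scheme.{u}} (φ : S ⟶ W) (D : S.IdealSheafData)
    (t : CentreSeq (blowup D)) (C : W.IdealSheafData) (P' : Option (Pending (blowup C))) :
    IsReplayStepPlus L Y j φ (CentreSeq.cons D t) C P' ↔ IsReplayStep L Y j φ (CentreSeq.cons D t) C P' :=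
  Iff.rfl

/-- **The two END rules coincide when the replayed subscheme IS the label part** (the CJS pending invariant). [folklore] -/
theorem isReplayStepPlus_nil_iff_of_range_eq (L : Labelling W) (Y : Set W) (j : ℕ) {S : Scheme.{u}} (φ : S ⟶ W)
    (hφ : Set.range φ.base = L.part Y j) (C : W.IdealSheafData) (P' : Option (Pending (blowup C))) :
    IsReplayStepPlus L Y j φ (CentreSeq.nil S) C P' ↔ IsReplayStep L Y j φ (CentreSeq.nil S) C P' := by
  rw [isReplayStepPlus_nil_iff, isReplayStep_nil_iff]
  refine and_congr ?_ Iff.rfl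
  constructor
  · rintro ⟨h, rfl⟩
    refine ⟨hφ ▸ h, ?_⟩
    congr 1
    exact Closeds.ext hφ
  · rintro ⟨h, rfl⟩
    refine ⟨hφ.symm ▸ h, ?_⟩
    congr 1
    exact Closeds.ext hφ.symm

/-- An Ω⁺ replay step is determined by its data: the centre … [cite: CossartJannsenSaito2020, Rem. 6.29 (1)] -/
theorem IsReplayStepPlus.centre_unique {L : Labelling W} {Y : Set W} {j : ℕ} {S : Scheme.{u}} {φ : S ⟶ W} {t : CentreSeq S}
    {C₁ C₂ : W.IdealSheafData} {P₁ : Option (Pending (blowup C₁))} {P₂ : Option (Pending (blowup C₂))}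
    (h₁ : IsReplayStepPlus L Y j φ t C₁ P₁) (h₂ : IsReplayStepPlus L Y j φ t C₂ P₂) : C₁ = C₂ := by
  cases t with
  | nil _ =>
    obtain ⟨⟨_, rfl⟩, -⟩ := h₁
    obtain ⟨⟨_, rfl⟩, -⟩ := h₂
    rfl
  | cons D t =>
    have h₁' : IsReplayStep L Y j φ (CentreSeq.cons D t) C₁ P₁ := h₁
    have h₂' : IsReplayStep L Y j φ (CentreSeq.cons D t) C₂ P₂ := h₂
    exact IsReplayStep.centre_unique h₁' h₂'

/-- … and, over a closed immersion, the next cycle state. [cite: CossartJannsenSaito2020, Rem. 6.29 (1)] -/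
theorem IsReplayStepPlus.pending_unique {L : Labelling W} {Y : Set W} {j : ℕ} {S : Scheme.{u}} {φ : S ⟶ W} [IsClosedImmersion φ]
    {t : CentreSeq S} {C : W.IdealSheafData} {P₁ P₂ : Option (Pending (blowup C))}
    (h₁ : IsReplayStepPlus L Y j φ t C P₁) (h₂ : IsReplayStepPlus L Y j φ t C P₂) : P₁ = P₂ := by
  cases t with
  | nil _ =>
    obtain ⟨-, rfl⟩ := h₁
    obtain ⟨-, rfl⟩ := h₂
    rfl
  | cons D t =>
    have h₁' : IsReplayStep L Y j φ (CentreSeq.cons D t) C P₁ := h₁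
    have h₂' : IsReplayStep L Y j φ (CentreSeq.cons D t) C P₂ := h₂
    exact IsReplayStep.pending_unique h₁' h₂'

/-! ## §2. The Ω⁺ step, its admissibility, functionality -/

/-- [OURS · L1 W4.2] **ONE STEP OF THE CYCLE-DISCIPLINED SEQUENCE, END-RULE VARIANT, DRIVEN BY THE STAGE ORACLE `ω`** — `IsCanonicalStepΩ`
with `IsReplayStep` replaced by `IsReplayStepPlus`: least non-empty label, reduced structure on its part, the oracle's sequence ON THE
EMBEDDED PART, replay, and a cycle END that blows up the strict transform of the part. NOT a statement of the manuscript.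
[cite: CossartJannsenSaito2020, Rem. 6.29 (1)] -/
def IsCanonicalStepΩplus (ω : StageOracle.{u}) (hW : IsLocallyNoetherian W) (N : ℕ) (ν : ℕ → ℕ) (L : Labelling W) :
    Option (Pending W) → (C : W.IdealSheafData) → Option (Pending (blowup C)) → Prop
  | none, C, P' =>
      ∃ j, IsLeast {i | (L.part (Scheme.hsStratum W N ν) i).Nonempty} j ∧
        ∃ h : IsClosed (L.part (Scheme.hsStratum W N ν) j),
          ∃ t : CentreSeq
              (Scheme.IdealSheafData.vanishingIdeal ⟨L.part (Scheme.hsStratum W N ν) j, h⟩).subscheme,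
            ω.names W hW N ν L _
                (Scheme.IdealSheafData.vanishingIdeal ⟨L.part (Scheme.hsStratum W N ν) j, h⟩).subschemeι t ∧
              IsReplayStepPlus L (Scheme.hsStratum W N ν) j
                (Scheme.IdealSheafData.vanishingIdeal ⟨L.part (Scheme.hsStratum W N ν) j, h⟩).subschemeι t C P'
  | some P, C, P' =>
      (Scheme.hsStratum W N ν).Nonempty ∧ IsReplayStepPlus L (Scheme.hsStratum W N ν) P.lbl P.hom P.rest C P'

/-- Unfolding: a step between cycles. [cite: CossartJannsenSaito2020, Rem. 6.29 (1)] -/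
theorem isCanonicalStepΩplus_none_iff (ω : StageOracle.{u}) (hW : IsLocallyNoetherian W) (N : ℕ) (ν : ℕ → ℕ) (L : Labelling W)
    (C : W.IdealSheafData) (P' : Option (Pending (blowup C))) :
    IsCanonicalStepΩplus ω hW N ν L none C P' ↔
      ∃ j, IsLeast {i | (L.part (Scheme.hsStratum W N ν) i).Nonempty} j ∧
        ∃ h : IsClosed (L.part (Scheme.hsStratum W N ν) j),
          ∃ t : CentreSeq
              (Scheme.IdealSheafData.vanishingIdeal ⟨L.part (Scheme.hsStratum W N ν) j, h⟩).subscheme,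
            ω.names W hW N ν L _
                (Scheme.IdealSheafData.vanishingIdeal ⟨L.part (Scheme.hsStratum W N ν) j, h⟩).subschemeι t ∧
              IsReplayStepPlus L (Scheme.hsStratum W N ν) j
                (Scheme.IdealSheafData.vanishingIdeal ⟨L.part (Scheme.hsStratum W N ν) j, h⟩).subschemeι t C P' :=
  Iff.rfl

/-- Unfolding: a step inside a cycle. [cite: CossartJannsenSaito2020, Rem. 6.29 (1)] -/
theorem isCanonicalStepΩplus_some_iff (ω : StageOracle.{u}) (hW : IsLocallyNoetherian W) (N : ℕ) (ν : ℕ → ℕ) (L : Labelling W)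
    (P : Pending W) (C : W.IdealSheafData) (P' : Option (Pending (blowup C))) :
    IsCanonicalStepΩplus ω hW N ν L (some P) C P' ↔
      (Scheme.hsStratum W N ν).Nonempty ∧ IsReplayStepPlus L (Scheme.hsStratum W N ν) P.lbl P.hom P.rest C P' :=
  Iff.rfl

variable {ω : StageOracle.{u}} {hW : IsLocallyNoetherian W} {N : ℕ} {ν : ℕ → ℕ}

/-- No Ω⁺-step leaves a stage whose `ν`-stratum is empty. [cite: CossartJannsenSaito2020, Rem. 6.29 (1)] -/
theorem IsCanonicalStepΩplus.hsStratum_nonempty {L : Labelling W} {P : Option (Pending W)} {C : W.IdealSheafData}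
    {P' : Option (Pending (blowup C))} (h : IsCanonicalStepΩplus ω hW N ν L P C P') : (Scheme.hsStratum W N ν).Nonempty := by
  cases P with
  | none =>
    obtain ⟨j, hj, -⟩ := h
    exact (L.exists_part_nonempty_iff _).mp ⟨j, hj.1⟩
  | some P => exact h.1

/-- [OURS · L1 W4.2] **ADMISSIBLE STAGE ORACLE, Ω⁺ form**: every named sequence has REGULAR centres (regular closed subschemes of the
part's tower — points AND whole regular components allowed) and a REGULAR last stage. Permissibility FOR THE STAGE of the pushed-forward
centres is a consequence along runs inside the `ν`-stratum with `ν` maximal (CJS Thm. 3.3 / Lemma 5.34 (3), the tree's centre package),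
not a clause. DELIBERATELY NOT REQUIRED here (to be settled with res-D-pv-047's `IsAdmissibleStrategy` clause (iii) «non-empty centres»):
non-emptiness of the named centres, and non-emptiness of the END centre — an oracle that names ALL components of the part mid-cycle leaves
an empty strict transform, so its cycle END is an identity step; rows quantifying `IsAdmissibleStrategyOn …` simply do not speak about
such oracles. NOT a statement of the manuscript. [cite: CossartJannsenSaito2020, Thm. 3.3, Lemma 5.34 (3), Rem. 6.29 (1)] -/
def OracleAdmissibleΩplus (ω : StageOracle.{u}) : Prop :=
  ∀ (W : Scheme.{u}) (hW : IsLocallyNoetherian W) (N : ℕ) (ν : ℕ → ℕ) (L : Labelling W) (S : Scheme.{u}) (φ : S ⟶ W)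
    (t : CentreSeq S), ω.names W hW N ν L S φ t →
    t.AllRegular ∧ Literature.AlgebraicGeometry.Resolution.Scheme.IsRegular t.top

/-- For a functional stage oracle the Ω⁺-step has a well-determined centre. [cite: CossartJannsenSaito2020, Rem. 6.29 (1)] -/
theorem IsCanonicalStepΩplus.centre_unique (hω : OracleFunctionalΩ ω) {L : Labelling W} {P : Option (Pending W)}
    {C₁ C₂ : W.IdealSheafData} {P₁ : Option (Pending (blowup C₁))} {P₂ : Option (Pending (blowup C₂))}
    (h₁ : IsCanonicalStepΩplus ω hW N ν L P C₁ P₁) (h₂ : IsCanonicalStepΩplus ω hW N ν L P C₂ P₂) : C₁ = C₂ := by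
  cases P with
  | none =>
    obtain ⟨j₁, hj₁, hcl₁, t₁, hR₁, hs₁⟩ := h₁
    obtain ⟨j₂, hj₂, hcl₂, t₂, hR₂, hs₂⟩ := h₂
    obtain rfl : j₁ = j₂ := hj₁.unique hj₂
    obtain rfl : t₁ = t₂ := hω _ _ _ _ _ _ _ _ _ hR₁ hR₂
    exact hs₁.centre_unique hs₂
  | some P => exact IsReplayStepPlus.centre_unique h₁.2 h₂.2

/-- … and a well-determined next state. [cite: CossartJannsenSaito2020, Rem. 6.29 (1)] -/
theorem IsCanonicalStepΩplus.pending_unique (hω : OracleFunctionalΩ ω) {L : Labelling W} {P : Option (Pending W)}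
    {C : W.IdealSheafData} {P₁ P₂ : Option (Pending (blowup C))}
    (h₁ : IsCanonicalStepΩplus ω hW N ν L P C P₁) (h₂ : IsCanonicalStepΩplus ω hW N ν L P C P₂) : P₁ = P₂ := by
  cases P with
  | none =>
    obtain ⟨j₁, hj₁, hcl₁, t₁, hR₁, hs₁⟩ := h₁
    obtain ⟨j₂, hj₂, hcl₂, t₂, hR₂, hs₂⟩ := h₂
    obtain rfl : j₁ = j₂ := hj₁.unique hj₂
    obtain rfl : t₁ = t₂ := hω _ _ _ _ _ _ _ _ _ hR₁ hR₂
    exact hs₁.pending_unique hs₂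
  | some P =>
    haveI := P.isClosedImmersion
    exact IsReplayStepPlus.pending_unique h₁.2 h₂.2

/-! ## §3. Transport: Ω⁺ = Ω (hence = the CJS step for the lifted oracle) on states under the pending invariant -/

/-- **Ω⁺ AND Ω AGREE ON EVERY STATE WHOSE REPLAYED SUBSCHEME IS THE LABEL PART** (the CJS pending invariant, tree `CycleInv.pending`):
between cycles the replayed subscheme is `V(Y^{(j)})` itself, whose range is the part; inside a cycle the hypothesis says so.
[cite: CossartJannsenSaito2020, Rem. 6.29 (1)] -/
theorem isCanonicalStepΩplus_iff_of_pending {L : Labelling W} {P : Option (Pending W)}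
    (hpend : ∀ Q, P = some Q → Set.range Q.hom.base = L.part (Scheme.hsStratum W N ν) Q.lbl)
    (C : W.IdealSheafData) (P' : Option (Pending (blowup C))) :
    IsCanonicalStepΩplus ω hW N ν L P C P' ↔ IsCanonicalStepΩ ω hW N ν L P C P' := by
  cases P with
  | none =>
    rw [isCanonicalStepΩplus_none_iff, isCanonicalStepΩ_none_iff]
    refine exists_congr fun j => and_congr Iff.rfl (exists_congr fun hcl => exists_congr fun t => and_congr Iff.rfl ?_)
    have hrange : Set.range (Scheme.IdealSheafData.vanishingIdeal
        ⟨L.part (Scheme.hsStratum W N ν) j, hcl⟩).subschemeι.base = L.part (Scheme.hsStratum W N ν) j := by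
      rw [Scheme.IdealSheafData.range_subschemeι, Scheme.IdealSheafData.coe_support_vanishingIdeal]
      rfl
    cases t with
    | nil _ => exact isReplayStepPlus_nil_iff_of_range_eq L _ j _ hrange C P'
    | cons D t => exact Iff.rfl
  | some Q =>
    rw [isCanonicalStepΩplus_some_iff, isCanonicalStepΩ_some_iff]
    refine and_congr Iff.rfl ?_
    have hrange := hpend Q rfl
    revert hrange
    cases Q.rest with
    | nil _ => exact fun hrange => isReplayStepPlus_nil_iff_of_range_eq L _ Q.lbl Q.hom hrange C P'
    | cons D t => exact fun _ => Iff.rfl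

/-- **… hence Ω⁺ for the lifted CJS oracle IS the CJS step on such states.** [cite: CossartJannsenSaito2020, Rem. 6.29 (1)] -/
theorem isCanonicalStepΩplus_lift_iff_of_pending (R : ∀ S : Scheme.{u}, CentreSeq S → Prop) {L : Labelling W}
    {P : Option (Pending W)} (hpend : ∀ Q, P = some Q → Set.range Q.hom.base = L.part (Scheme.hsStratum W N ν) Q.lbl)
    (C : W.IdealSheafData) (P' : Option (Pending (blowup C))) :
    IsCanonicalStepΩplus (StageOracle.lift R) hW N ν L P C P' ↔ IsCanonicalStep R N ν L P C P' :=
  (isCanonicalStepΩplus_iff_of_pending hpend C P').trans (isCanonicalStepΩ_lift_iff R hW N ν L P C P')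

/-! ## §4. The Ω⁺ strategies inside `Sigma.Strategy` -/

/-- [OURS · L1 W4.2] **THE Ω⁺ STRATEGY OF A STAGE ORACLE** (cycle discipline of Rem. 6.29 (1) with the END rule on the replayed
subscheme; in-cycle centres by `ω`, components allowed). NOT a statement of the manuscript. [cite: CossartJannsenSaito2020, Rem. 6.29 (1)] -/
def Strategy.ofStageOraclePlus (ω : StageOracle.{u}) : Strategy.{u} :=
  ⟨fun _ hW N ν L P C P' => IsCanonicalStepΩplus ω hW N ν L P C P'⟩

/-- Unfolding (`Iff.rfl`). [folklore] -/
theorem Strategy.ofStageOraclePlus_step_iff (ω : StageOracle.{u}) (W : Scheme.{u}) (hW : IsLocallyNoetherian W) (N : ℕ)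
    (ν : ℕ → ℕ) (L : Labelling W) (P : Option (Pending W)) (C : W.IdealSheafData) (P' : Option (Pending (blowup C))) :
    (Strategy.ofStageOraclePlus ω).step W hW N ν L P C P' ↔ IsCanonicalStepΩplus ω hW N ν L P C P' :=
  Iff.rfl

/-- The Ω⁺ strategy of a functional stage oracle is functional (res-D-pv-047's `Strategy.IsFunctional`). [folklore] -/
theorem Strategy.isFunctional_ofStageOraclePlus (hω : OracleFunctionalΩ ω) (N : ℕ) (ν : ℕ → ℕ) :
    (Strategy.ofStageOraclePlus ω).IsFunctional N ν :=
  fun _ _ _ _ =>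
    ⟨fun _ _ _ _ h₁ h₂ => IsCanonicalStepΩplus.centre_unique hω h₁ h₂,
      fun _ _ _ h₁ h₂ => IsCanonicalStepΩplus.pending_unique hω h₁ h₂⟩

end Summit.ResolutionOfSingularities.ResolutionOfSingularities.Theorems.SigmaMaxModificationsCorridor3.Sigma

end
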